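import Literature.AnabelianGeometry.EtaleTheta.Discharge.Sec2ModelTwistAutomorphisms
import HarnessLib

/-!
# [EtTh] Prop. 2.4 / Prop. 2.6 as typed over `ThetaCovers.TemperedCoverData` (`Prop24`, `Prop26`,
# `Prop26_profinite`): the universal closures are REFUTED at the tree's model (FACT-LIST F-0609, F-0610, F-0611)

S. Mochizuki, *The étale theta function and its Frobenioid-theoretic manifestations*, Publ. RIMS **45**
(2009) [EtTh], §2: Prop. 2.4 (PDF p. 38, printed 264) "any isomorphism of topological groups `Π^tp_{X̲̲_α} ⥲
Π^tp_{X̲̲_β}` … induces isomorphisms compatible with the various natural maps between the respective `Π^tp`'s of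
`C̲̲, C̲, C, X̲̲, X̲, X, Ÿ`", Prop. 2.6 (p. 40) — the dotted case, "a similar statement holds when `Π^tp` is
replaced by `Π`" [cite: MochizukiEtTh2009, Prop 2.4 p.38] [cite: MochizukiEtTh2009, Prop 2.6 p.40].

PROOF-ONLY companion (no definition, no new named fact) of abc-iut-L2-t2's statements file
`ThetaCoversTempered.lean` and of abc-iut-w5-d118's MODEL `Discharge/Sec2TemperedCoverDataModel.lean`
(`TemperedModel.exists_model`: for every odd `l ≠ 1` an inhabitant of `TemperedCoverData l` with
`Π^tp_C := (heisPiC l × ℤ/2) × ℤ ↪ Π_C := Â × Ẑ`, `G_K := 1`, `K ⊇ μ_l`; the structure literal is re-assembled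
here from that file's public field lemmas, nothing is edited or restated).  abc-iut cell, block F (fact-proving
wave), seat abc-iut-f-143, tranche 143 = rows F-0609 `TemperedCoverData.Prop24`, F-0610 `TemperedCoverData.Prop26`,
F-0611 `TemperedCoverData.Prop26_profinite` (class `preparatory`, `parametrised`: schemata over the binder
`T : TemperedCoverData l`).

WHAT IS PROVED.  The three typed statements quantify over ALL topological automorphisms `γ` of the `Π^tp`
(resp. `Π`) of a member of the tower of §2 and assert that `γ` EXTENDS to `Π^tp_C` (resp. `Π_C`) stabilising a
printed list.  In print this is absolute anabelian geometry (`C` is a `K`-core, [Mzk3] Thm. 2.4; [Mzk2]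
Lem. 1.3.8; cusps are preserved, [Mzk14] Thm. 6.5 (iii); Thm. 1.6 (i); Prop. 2.2) — content the interface
`TemperedCoverData` does not carry, and here is the kernel certificate that it does not: at the model, the twist
automorphisms of part 1 (`Discharge/Sec2ModelTwistAutomorphisms.lean`: `exists_twist_not_extends` on
`Π^tp_{C̲̲}` and on `Π^tp_{C̲̲} ∩ Π^tp_Ċ`, `exists_twist_not_extends_hat` on `cl(toHat(Π^tp_{C̲̲} ∩ Π^tp_Ċ))`) have
NO extension at all, so `Prop24` fails at clause (iii) (`Π^tp_{C̲̲}`), `Prop26` and `Prop26_profinite` fail at the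
member `Z = Π^tp_{C̲̲}` — `exists_model_not_prop24_prop26` (one model violating all three, with `K ⊇ μ_l`),
`not_forall_prop24`, `not_forall_prop26`, `not_forall_prop26_profinite` (every odd `l ≠ 1`), and the
`l`-quantified closures `not_forall_forall_prop24` / `…prop26` / `…prop26_profinite`.

HONEST FRAMING.  This refutes only the UNIVERSAL CLOSURES of the typed schemata over the abstract interface (FACT-LIST
class «universal-closure REFUTED / schema; instance forms open»): the model is a consistency toy, not the tempered
fundamental group of a curve.  The INSTANCE forms the cone consumes — `T.Prop24` / `T.Prop26` at the [EtTh] §1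
setting (`Sec2Prop24Reduction`, `Sec2AutKDotted`, `Sec2CuspDecompositionReduction`, `Sec5TransportsOfBiKummerData`
take them BY NAME) — ARE the printed Prop. 2.4 / 2.6 and remain named assumptions (absolute anabelian geometry,
not in Mathlib).  [EtTh] is refereed; nothing here asserts or denies its statements; no side is taken on
[IUTchIII] Cor. 3.12; typed ≠ proved.
-/

noncomputable section

namespace Literature.AnabelianGeometry.EtaleTheta

namespace ThetaCovers

namespace TemperedModel

open Multiplicative HeisenbergWitness Literature.AnabelianGeometry.SemiGraphs
  Literature.AnabelianGeometry.EtaleTheta.SettingModel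

variable (l : ℕ) [NeZero l]

/-! ## The model and the refutations -/

/-- **The model violates `Prop24`, `Prop26` and `Prop26_profinite`.**  For every odd `l ≠ 1` there is a
`T : TemperedCoverData l` (abc-iut-w5-d118's model; `K ⊇ μ_l` holds there, so nothing is vacuous) such that the
typed [EtTh] Prop. 2.4 FAILS (clause (iii): the twist `γ_z` of `Π^tp_{C̲̲}` has no extension to `Π^tp_C`), the
typed Prop. 2.6 FAILS (member `Z = Π^tp_{C̲̲}`: the twist of `Π^tp_{C̲̲} ∩ Π^tp_Ċ` has no extension) and its
profinite clause FAILS (the twist of `cl(toHat(Π^tp_{C̲̲} ∩ Π^tp_Ċ)) ⊆ Π_C` has no extension to `Π_C`).  Universal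
closures only; the printed statements concern (tempered) fundamental groups of curves.
[cite: MochizukiEtTh2009, Prop 2.4 p.38] -/
theorem exists_model_not_prop24_prop26 (hl : Odd l) (hl1 : l ≠ 1) :
    ∃ T : TemperedCoverData.{0} l, T.HasMuL ∧ ¬ T.Prop24 ∧ ¬ T.Prop26 ∧ ¬ T.Prop26_profinite := by
  haveI := TAX_normal l
  haveI : ((TAX l).prod (⊥ : Subgroup (Multiplicative ℤ))).Normal := Subgroup.prod_normal _ _
  let T : TemperedCoverData.{0} l :=
    { toCoverDataAx := coverDataAx l hl
      PiCuu := PiCuuM l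
      isTypeLTorsThetaPm := isTypeLTorsThetaPm_PiCuuM l hl
      isOpen_PiCuu' := isOpen_PiCuuM l
      Gtp := GtpM l
      toHat := (toHatM l).toMonoidHom
      continuous_toHat := (toHatM l).continuous
      injective_toHat := toHatM_injective l
      isProfiniteCompletion_toHat := isProfiniteCompletion_prodMap_etaCont (TA l) (Multiplicative ℤ)
      PiYtp := (TAX l).prod ⊥
      PiYtp_le := by
        change (TAX l).prod ⊥ ≤ (PiXM l).comap (toHatM l).toMonoidHom
        rw [comap_toHatM_PiXM]
        exact Subgroup.prod_mono le_rfl bot_le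
      PiYtp_normal := inferInstance
      isOpen_PiYtp := isOpen_discrete _
      quotZ := nonempty_quotZ l
      PiYddtp := ((TAX l ⊓ (TA.two l).ker)).prod ⊥
      PiYddtp_le := Subgroup.prod_mono inf_le_left le_rfl
      isOpen_PiYddtp := isOpen_discrete _
      relIndex_PiYddtp := relIndex_PiYddtp l
      PiCdot := ((TA.two l).ker).prod ⊤
      index_PiCdot := index_PiCdot l
      isOpen_PiCdot := isOpen_discrete _
      PiCdot_ne := PiCdot_ne l }
  -- `Π^tp_{C̲̲}` of the model and the three membership facts
  have hH : T.tp T.PiCuu = (PiCuuM l).comap (toHatM l).toMonoidHom := rfl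
  have hA : ∀ x ∈ T.tp T.PiCuu, (l : ℤ) ∣ toAdd x.2 := fun x hx =>
    dvd_of_mem_comap_PiCuuM l (hH ▸ hx)
  have hB : ((TA.mk l (thetaEmb l (ofAdd 1)) 1, 1) : GtpM l) ∈ T.tp T.PiCuu :=
    hH ▸ zG_mem_comap_PiCuuM l
  have hC : (((1 : TA l), ofAdd (l : ℤ)) : GtpM l) ∈ T.tp T.PiCuu := hH ▸ gl_mem_comap_PiCuuM l
  have hBdot : ((TA.mk l (thetaEmb l (ofAdd 1)) 1, 1) : GtpM l) ∈ T.PiCdot := ⟨rfl, trivial⟩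
  have hCdot : (((1 : TA l), ofAdd (l : ℤ)) : GtpM l) ∈ T.PiCdot := ⟨rfl, trivial⟩
  -- the profinite closure `W = cl(toHat(Π^tp_{C̲̲} ∩ Π^tp_Ċ))` and its three membership facts
  let W : Subgroup (PiCM l) := ((T.tp T.PiCuu ⊓ T.PiCdot).map (toHatM l).toMonoidHom).topologicalClosure
  have hWle : W ≤ (Psi l).ker := by
    refine Subgroup.topologicalClosure_minimal _ ?_ (isClosed_ker_Psi l)
    rw [Subgroup.map_le_iff_le_comap]
    exact fun y hy => PiCuuM_le_ker_Psi l (hH ▸ hy.1 :)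
  have hA' : ∀ x ∈ W, piL l x.2 = 1 := fun x hx => by
    have h1 := hWle hx
    rwa [MonoidHom.mem_ker] at h1
  have hB' : ((etaCont (TA l) (TA.mk l (thetaEmb l (ofAdd 1)) 1), 1) : PiCM l) ∈ W := by
    refine Subgroup.le_topologicalClosure _ (Subgroup.mem_map.mpr ⟨_, ⟨hB, hBdot⟩, ?_⟩)
    change toHatM l _ = _
    rw [toHatM_apply, map_one (etaCont (Multiplicative ℤ))]
  have hC' : (((1 : Ahat l)), etaCont (Multiplicative ℤ) (ofAdd (l : ℤ))) ∈ W := by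
    refine Subgroup.le_topologicalClosure _ (Subgroup.mem_map.mpr ⟨_, ⟨hC, hCdot⟩, ?_⟩)
    change toHatM l _ = _
    rw [toHatM_apply, map_one (etaCont (TA l))]
  refine ⟨T, fun c t ht => hasMuL_model l hl c ht, ?_, ?_, ?_⟩
  · -- Prop. 2.4 (iii) fails: the twist of `Π^tp_{C̲̲}`
    obtain ⟨γ, hγ⟩ := exists_twist_not_extends l hl hl1 (T.tp T.PiCuu) hA hB hC
    intro h24
    obtain ⟨Γ, hΓ, -⟩ := h24.2.2.1 γ
    exact hγ Γ.toMulEquiv.toMonoidHom hΓ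
  · -- Prop. 2.6 fails at `Z = Π^tp_{C̲̲}`: the twist of `Π^tp_{C̲̲} ∩ Π^tp_Ċ`
    obtain ⟨γ, hγ⟩ := exists_twist_not_extends l hl hl1 (T.tp T.PiCuu ⊓ T.PiCdot)
      (fun x hx => hA x hx.1) ⟨hB, hBdot⟩ ⟨hC, hCdot⟩
    intro h26
    obtain ⟨Γ, hΓ, -⟩ := h26 (T.tp T.PiCuu) (by simp) γ
    exact hγ Γ.toMulEquiv.toMonoidHom hΓ
  · -- the profinite clause of Prop. 2.6 fails at `Z = Π^tp_{C̲̲}`: the twist of the closure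
    obtain ⟨γ, hγ⟩ := exists_twist_not_extends_hat l hl hl1 W hA' hB' hC'
    intro h26
    obtain ⟨Γ, hΓ, -⟩ := h26 (T.tp T.PiCuu) (by simp) γ
    exact hγ Γ.toMulEquiv.toMonoidHom hΓ

/-- **F-0609: the universal closure of the typed [EtTh] Prop. 2.4 is FALSE** over the interface
`ThetaCovers.TemperedCoverData l`, for every odd `l ≠ 1`. (Refutes the closure of a schema; the instance at the
[EtTh] setting is the printed, refereed Prop. 2.4 and stays a named assumption.) [cite: MochizukiEtTh2009, Prop 2.4 p.38] -/
theorem not_forall_prop24 (hl : Odd l) (hl1 : l ≠ 1) : ¬ ∀ T : TemperedCoverData.{0} l, T.Prop24 := by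
  obtain ⟨T, -, h24, -⟩ := exists_model_not_prop24_prop26 l hl hl1
  exact fun h => h24 (h T)

/-- **F-0610: the universal closure of the typed [EtTh] Prop. 2.6 (tempered clause) is FALSE** over the
interface, for every odd `l ≠ 1`. [cite: MochizukiEtTh2009, Prop 2.6 p.40] -/
theorem not_forall_prop26 (hl : Odd l) (hl1 : l ≠ 1) : ¬ ∀ T : TemperedCoverData.{0} l, T.Prop26 := by
  obtain ⟨T, -, -, h26, -⟩ := exists_model_not_prop24_prop26 l hl hl1
  exact fun h => h26 (h T)

/-- **F-0611: the universal closure of the typed profinite clause of [EtTh] Prop. 2.6 is FALSE** over the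
interface, for every odd `l ≠ 1`. [cite: MochizukiEtTh2009, Prop 2.6 p.40] -/
theorem not_forall_prop26_profinite (hl : Odd l) (hl1 : l ≠ 1) :
    ¬ ∀ T : TemperedCoverData.{0} l, T.Prop26_profinite := by
  obtain ⟨T, -, -, -, h26⟩ := exists_model_not_prop24_prop26 l hl hl1
  exact fun h => h26 (h T)

/-- The closure over `l` as well (at `l = 3`): `¬ ∀ l T, T.Prop24`. [cite: MochizukiEtTh2009, Prop 2.4 p.38] -/
theorem not_forall_forall_prop24 : ¬ ∀ (l : ℕ) (T : TemperedCoverData.{0} l), T.Prop24 :=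
  fun h => not_forall_prop24 3 (by decide) (by decide) (h 3)

/-- `¬ ∀ l T, T.Prop26`. [cite: MochizukiEtTh2009, Prop 2.6 p.40] -/
theorem not_forall_forall_prop26 : ¬ ∀ (l : ℕ) (T : TemperedCoverData.{0} l), T.Prop26 :=
  fun h => not_forall_prop26 3 (by decide) (by decide) (h 3)

/-- `¬ ∀ l T, T.Prop26_profinite`. [cite: MochizukiEtTh2009, Prop 2.6 p.40] -/
theorem not_forall_forall_prop26_profinite :
    ¬ ∀ (l : ℕ) (T : TemperedCoverData.{0} l), T.Prop26_profinite :=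
  fun h => not_forall_prop26_profinite 3 (by decide) (by decide) (h 3)

end TemperedModel

end ThetaCovers

end Literature.AnabelianGeometry.EtaleTheta
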